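import Literature.NumberTheory.LFunctions.Zhang2022.Section8Lemma84Contour
import Literature.NumberTheory.LFunctions.Zhang2022.Section8Lemma84Poles
import Literature.NumberTheory.LFunctions.Zhang2022.Section8Lemma84SmallRect
import HarnessLib

/-!
# Zhang (2022), Lemma 8.4 — IX: the whole contour argument, as one inequality with explicit pieces

Topic `Literature/NumberTheory/LFunctions/Zhang2022` (Landau–Siegel audit tree; verdict-neutral).
Y. Zhang, *Discrete mean estimates and the Landau–Siegel zero*, arXiv:2211.02515v1 (2022)
[Zhang2022LandauSiegel] — **an unrefereed manuscript under adjudication**; DAG nodes `Z22:(8.9)`,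
`Z22:Lem8.4.pf` [Z22 p.46–47, tex L2399–2418]: Perron's formula (8.9), "the contour of integration is
moved in the same way as in the proof of Lemma 8.2", the comparison with the model on the small
contour, "direct calculation".

This file PROVES the generic form of that argument (`norm_sum_log_sub_main_le`): for coefficients
`f` whose Dirichlet series is `Φ(u) = U(w)L(w+β_a,χ)L(w+β_b,χ)/L(w,χ)` (`w = 1 − β_μ + u`) on
`Re u = 9`, with `U` holomorphic on `σ > 9/10`, an exceptional real zero `ρ ∈ (1 − α/2, 1)` of
`L(·,χ)` that is its only zero in `Re w > 1 − 2η`, `|Im w| < T′ + 1`, and pointwise bounds `M_R`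
(`Re u ≥ α`), `M_l` (`Re u = −η`, `|t| ≤ T′`), `M_h` (`Im u = ±T′`), `Δ` (model comparison on the
small rectangle), one has for `x ≥ 1`, `L = log x`:
`‖∑_{n≤x} f(n)log(x/n) − M₀e^{β_μL}𝔤(β_a,β_b,β_μ;L)‖ ≤
  (2π)⁻¹(2e^{αL}M_R/T′ + e^{−ηL}M_lπ/η + 2(α+η)e^{αL}M_h/T′² + 56e^{αL/2}Δ/α)`
— Perron at `Re u = 9` shifted to `Re u = α` (`sum_log_eq_integral_shift`), the rectangle
`[−η, α] × [−T′, T′]` (`integral_line_decomp`), the residue theorem twice (`rect_big_eq_rect_small`),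
and the small-rectangle comparison (`norm_rectSmall_sub_main_le`).

Nothing about the manuscript's Theorems 1–2 or about Landau–Siegel zeros is asserted.

## References

* Y. Zhang, arXiv:2211.02515v1 (2022), §8 (8.9), Lemma 8.4 (proof). [cite: Zhang2022LandauSiegel, §8 Lemma 8.4]
* H. L. Montgomery, R. C. Vaughan, *Multiplicative Number Theory I*, CUP 2007, §5.1, §6.2.
  [cite: MontgomeryVaughan2007, §6.2]
-/

noncomputable section

open Complex Real Set MeasureTheory Filter Topology intervalIntegral

namespace Literature.NumberTheory.LFunctions.Zhang2022.Lemma84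

open Literature.Analysis.Complex

section ContourBound

variable {D : ℕ} [NeZero D] (χ : DirichletCharacter ℂ D)
variable (U Φ : ℂ → ℂ) (f : ℕ → ℂ) (M₀ βμ βa βb : ℂ)
variable {x ρ η α T' M_R M_l M_h Δ : ℝ}

/-- `‖(1/(2π) : ℂ)‖ = 1/(2π)` and `‖I/(2π)‖ = 1/(2π)`. [folklore] -/
private theorem norm_inv_two_pi :
    ‖(1 / (2 * π) : ℂ)‖ = 1 / (2 * π) ∧ ‖(I / (2 * π) : ℂ)‖ = 1 / (2 * π) := by
  have h2π : ‖(2 * π : ℂ)‖ = 2 * π := by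
    rw [norm_mul, Complex.norm_ofNat, Complex.norm_real, Real.norm_of_nonneg Real.pi_pos.le]
  constructor
  · rw [norm_div, norm_one, h2π]
  · rw [norm_div, Complex.norm_I, h2π]

/-- **The contour argument of Lemma 8.4 with explicit pieces.** See the module docstring for the
setting; the conclusion is
`‖∑_{n≤x} f(n)log(x/n) − M₀e^{β_μL}𝔤(β_a,β_b,β_μ;L)‖ ≤
  (2π)⁻¹(2e^{αL}M_R/T′ + e^{−ηL}M_lπ/η + 2(α+η)e^{αL}M_h/T′² + 56e^{αL/2}Δ/α)`, `L = log x`.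
[cite: Zhang2022LandauSiegel, §8 (8.9) and Lemma 8.4 (proof)] [cite: MontgomeryVaughan2007, §6.2] -/
theorem norm_sum_log_sub_main_le (hχ1 : χ ≠ 1)
    (hUd : DifferentiableOn ℂ U {s : ℂ | 9 / 10 < s.re})
    (hβμ : βμ.re = 0) (hβμ1 : 3 * α / 2 ≤ βμ.im) (hβμ2 : βμ.im ≤ 5 * α / 2)
    (hΦ : ∀ u, Φ u = U (1 - βμ + u) * χ.LFunction (1 - βμ + u + βa) *
      χ.LFunction (1 - βμ + u + βb) / χ.LFunction (1 - βμ + u))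
    (hx : 1 ≤ x) (hα : 0 < α) (hαη : α ≤ η) (hη : η ≤ 1 / 40) (hT : 1 ≤ T')
    (hρ1 : ρ < 1) (hρα : 1 - α / 2 < ρ) (hLρ : χ.LFunction ρ = 0)
    (hL'ρ : deriv χ.LFunction ρ ≠ 0)
    (hzf : ∀ w : ℂ, 1 - 2 * η < w.re → |w.im| < T' + 1 → w ≠ ρ → χ.LFunction w ≠ 0)
    (hf : LSeriesSummable f 9) (hfΦ : ∀ t : ℝ, LSeries f ((9 : ℝ) + t * I) = Φ ((9 : ℝ) + t * I))
    (hMR0 : 0 ≤ M_R) (hPhiR : ∀ u : ℂ, α ≤ u.re → χ.LFunction (1 - βμ + u) ≠ 0 ∧ ‖Φ u‖ ≤ M_R)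
    (hMl0 : 0 ≤ M_l) (hPhiL : ∀ t : ℝ, |t| ≤ T' → ‖Φ (((-η : ℝ) : ℂ) + t * I)‖ ≤ M_l)
    (hMh0 : 0 ≤ M_h)
    (hPhiH : ∀ x' y' : ℝ, -η ≤ x' → x' ≤ α → |y'| = T' → ‖Φ ((x' : ℂ) + y' * I)‖ ≤ M_h)
    (hΔ : ∀ u : ℂ, u.re ∈ Icc (-(α / 2)) (α / 2) → u.im ∈ Icc (βμ.im - 3 * α) (βμ.im + 3 * α) →
      (|u.re| = α / 2 ∨ |u.im - βμ.im| = 3 * α) →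
      ‖Φ u - M₀ * (u + (βa - βμ)) * (u + (βb - βμ)) / (u - βμ)‖ ≤ Δ) :
    ‖(∑ n ∈ Finset.Ioc 0 ⌊x⌋₊, f n * (Real.log (x / n) : ℂ)) -
        M₀ * cexp (βμ * (Real.log x : ℂ)) * frakg βa βb βμ (Real.log x : ℂ)‖ ≤
      1 / (2 * π) * (2 * (Real.exp (α * Real.log x) * M_R / T') +
        Real.exp (-η * Real.log x) * M_l * (π / η) +
        2 * ((α + η) * (Real.exp (α * Real.log x) * M_h / T' ^ 2)) +
        56 * Real.exp (α * Real.log x / 2) * Δ / α) := by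
  have hx0 : 0 < x := by linarith
  have hLx : 0 ≤ Real.log x := Real.log_nonneg hx
  have hη0 : 0 < η := lt_of_lt_of_le hα hαη
  have hβμim : 0 < βμ.im := by linarith
  have hβμim' : βμ.im ≤ 1 / 4 := by linarith
  have hβμα : βμ.im < 3 * α := by linarith
  -- the integrand `E(u) = e^{uL}Φ(u)/u²`
  set E : ℂ → ℂ := fun u => cexp (u * (Real.log x : ℂ)) * Φ u / u ^ 2 with hE
  have hEu : ∀ u, E u = cexp (u * (Real.log x : ℂ)) * Φ u / u ^ 2 := fun u => rfl
  -- differentiability of `Φ` to the right of `Re u = α`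
  have hΦdiff : ∀ u : ℂ, α ≤ u.re → DifferentiableAt ℂ Φ u := fun u hu =>
    differentiableAt_Phi χ U Φ βμ βa βb hχ1 hUd hβμ hΦ (by linarith) (hPhiR u hu).1
  have hΦd : DifferentiableOn ℂ Φ (re ⁻¹' Icc α 9) := fun u hu =>
    (hΦdiff u hu.1).differentiableWithinAt
  -- Perron at `Re u = 9`, shifted to `Re u = α`
  have hP := sum_log_eq_integral_shift (f := f) hx hα (by linarith : α ≤ (9 : ℝ)) hf hΦd hfΦ
    (M := M_R) (fun u h1 _ => (hPhiR u h1).2)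
  -- integrability on `Re u = α`
  have hcont : Continuous fun t : ℝ => Φ ((α : ℂ) + t * I) := by
    have hline : Continuous fun t : ℝ => (α : ℂ) + t * I := by fun_prop
    exact continuous_iff_continuousAt.2 fun t =>
      ((hΦdiff _ (by simp)).continuousAt).comp hline.continuousAt
  have hint : Integrable fun t : ℝ => E ((α : ℂ) + t * I) :=
    integrable_line (L := Real.log x) hα hcont (fun t => (hPhiR _ (by simp)).2)
  -- the rectangle decomposition of the shifted line
  have hdec := integral_line_decomp (Θ := E) (σ₀ := α) (σ₁ := η) (T := T') hint
  -- the residue bookkeeping: big rectangle = small rectangle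
  have hRR := rect_big_eq_rect_small χ U Φ E βμ βa βb (Real.log x : ℂ) ρ η α T' hχ1 hUd hβμ
    hβμim hβμim' hΦ hEu hαη hη hT hβμα hρ1 hρα hLρ hL'ρ hzf
  -- the small rectangle against the model
  have hGc : ∀ u : ℂ, u.re ∈ Icc (-(α / 2)) (α / 2) →
      u.im ∈ Icc (βμ.im - 3 * α) (βμ.im + 3 * α) → (|u.re| = α / 2 ∨ |u.im - βμ.im| = 3 * α) →
      ContinuousAt E u := by
    intro u hre him hb
    obtain ⟨hnorm, -, hu0, -⟩ := bdry_facts hα hβμ hβμ1 hβμ2 hre hb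
    have hLne : χ.LFunction (1 - βμ + u) ≠ 0 := by
      refine hzf _ ?_ ?_ ?_
      · simp only [add_re, sub_re, one_re, hβμ]; linarith [hre.1]
      · have : (1 - βμ + u).im = u.im - βμ.im := by simp; ring
        rw [this, abs_lt]; constructor <;> linarith [him.1, him.2]
      · intro h
        have hure : u.re = ρ - 1 := by
          have := congrArg Complex.re h
          simp only [add_re, sub_re, one_re, hβμ, Complex.ofReal_re] at this
          linarith
        have huim : u.im = βμ.im := by
          have := congrArg Complex.im h
          simp only [add_im, sub_im, one_im, Complex.ofReal_im] at this
          linarith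
        rcases hb with h' | h'
        · rw [hure] at h'
          rcases (abs_eq (by positivity : (0 : ℝ) ≤ α / 2)).1 h' with h'' | h'' <;> linarith
        · rw [huim, sub_self, abs_zero] at h'; linarith
    have hd := differentiableAt_Phi χ U Φ βμ βa βb hχ1 hUd hβμ hΦ (u := u) (by linarith [hre.1]) hLne
    exact (differentiableAt_G Φ E (Real.log x : ℂ) hEu hd hu0).continuousAt
  have hsmall := norm_rectSmall_sub_main_le (M₀ := M₀) (βa := βa) (βb := βb) hα hLx hβμ hβμ1 hβμ2
    hEu hΔ hGc
  -- the bounds for the pieces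
  have htails := norm_tails_le (Φ := Φ) (L := Real.log x) hα hT hMR0
    (fun t _ => (hPhiR _ (by simp)).2)
  have hleft := norm_left_le (Φ := Φ) (L := Real.log x) (T := T') hη0 (by linarith) hMl0 hPhiL
  have hB : ∀ (y' : ℝ) (_ : |y'| = T') (u : ℝ), -η ≤ u → u ≤ α →
      ‖E ((u : ℂ) + (y' : ℂ) * I)‖ ≤ Real.exp (α * Real.log x) * M_h / T' ^ 2 := by
    intro y' hy' u hu1 hu2
    have hsq : u ^ 2 + y' ^ 2 ≠ 0 := by
      have : y' ^ 2 = T' ^ 2 := by rw [← sq_abs, hy']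
      nlinarith
    have h := norm_G_line_le (L := Real.log x) (σ := u) (t := y') (hPhiH u y' hu1 hu2 hy') hsq
    rw [hEu]
    refine h.trans ?_
    have hT2 : T' ^ 2 ≤ u ^ 2 + y' ^ 2 := by
      have : y' ^ 2 = T' ^ 2 := by rw [← sq_abs, hy']
      nlinarith
    have hnum : Real.exp (u * Real.log x) * M_h ≤ Real.exp (α * Real.log x) * M_h :=
      mul_le_mul_of_nonneg_right (Real.exp_le_exp.2 (mul_le_mul_of_nonneg_right hu2 hLx)) hMh0
    exact div_le_div₀ (by positivity) hnum (by positivity) hT2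
  have hbot := norm_horizontal_le (Θ := E) (σ₀ := α) (σ₁ := η) (T' := -T')
    (B := Real.exp (α * Real.log x) * M_h / T' ^ 2) (by linarith)
    (hB (-T') (by rw [abs_neg, abs_of_pos (by linarith)]))
  have htop := norm_horizontal_le (Θ := E) (σ₀ := α) (σ₁ := η) (T' := T')
    (B := Real.exp (α * Real.log x) * M_h / T' ^ 2) (by linarith)
    (hB T' (abs_of_pos (by linarith)))
  -- names for the pieces
  set T₁ : ℂ := ∫ t in Iic (-T'), E ((α : ℂ) + t * I) with hT₁
  set T₂ : ℂ := ∫ t in Ioi T', E ((α : ℂ) + t * I) with hT₂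
  set Lf : ℂ := ∫ t in (-T')..T', E (((-η : ℝ) : ℂ) + t * I) with hLf
  set Bo : ℂ := ∫ u in (-η)..α, E (u + ((-T' : ℝ) : ℂ) * I) with hBo
  set Tp : ℂ := ∫ u in (-η)..α, E (u + (T' : ℂ) * I) with hTp
  set Rs : ℂ := rectBoundaryIntegral E (-(α / 2)) (α / 2) (βμ.im - 3 * α) (βμ.im + 3 * α) with hRs
  set X : ℂ := M₀ * cexp (βμ * (Real.log x : ℂ)) * frakg βa βb βμ (Real.log x : ℂ) with hX
  have hS : (∑ n ∈ Finset.Ioc 0 ⌊x⌋₊, f n * (Real.log (x / n) : ℂ)) =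
      (1 / (2 * π) : ℂ) * (T₁ + T₂ + Lf + I * Bo - I * Tp - I * Rs) := by
    rw [hP]
    congr 1
    rw [← hRR, ← hdec]
  have key : (∑ n ∈ Finset.Ioc 0 ⌊x⌋₊, f n * (Real.log (x / n) : ℂ)) - X =
      (1 / (2 * π) : ℂ) * (T₁ + T₂ + Lf + I * Bo - I * Tp) -
        (I / (2 * π)) * (Rs - 2 * π * I * X) := by
    rw [hS]
    have hπ : (π : ℂ) ≠ 0 := by exact_mod_cast Real.pi_ne_zero
    field_simp
    linear_combination (-(2 : ℂ) * π * X) * I_sq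
  obtain ⟨n1, n2⟩ := norm_inv_two_pi
  have hπ0 : 0 < 1 / (2 * π) := by positivity
  rw [key]
  -- norms of the pieces
  have hnT : ‖T₂‖ + ‖T₁‖ ≤ 2 * (Real.exp (α * Real.log x) * M_R / T') := htails
  have hnL : ‖Lf‖ ≤ Real.exp (-η * Real.log x) * M_l * (π / η) := hleft
  have hnBo : ‖Bo‖ ≤ (α + η) * (Real.exp (α * Real.log x) * M_h / T' ^ 2) := hbot
  have hnTp : ‖Tp‖ ≤ (α + η) * (Real.exp (α * Real.log x) * M_h / T' ^ 2) := htop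
  have hnRs : ‖Rs - 2 * π * I * X‖ ≤ 56 * Real.exp (α * Real.log x / 2) * Δ / α := hsmall
  calc ‖(1 / (2 * π) : ℂ) * (T₁ + T₂ + Lf + I * Bo - I * Tp) - (I / (2 * π)) * (Rs - 2 * π * I * X)‖
      ≤ ‖(1 / (2 * π) : ℂ) * (T₁ + T₂ + Lf + I * Bo - I * Tp)‖ +
          ‖(I / (2 * π)) * (Rs - 2 * π * I * X)‖ := norm_sub_le _ _
    _ = 1 / (2 * π) * ‖T₁ + T₂ + Lf + I * Bo - I * Tp‖ +
          1 / (2 * π) * ‖Rs - 2 * π * I * X‖ := by rw [norm_mul, norm_mul, n1, n2]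
    _ ≤ 1 / (2 * π) * (‖T₁‖ + ‖T₂‖ + ‖Lf‖ + ‖Bo‖ + ‖Tp‖) +
          1 / (2 * π) * ‖Rs - 2 * π * I * X‖ := by
        gcongr
        calc ‖T₁ + T₂ + Lf + I * Bo - I * Tp‖
            ≤ ‖T₁ + T₂ + Lf + I * Bo‖ + ‖I * Tp‖ := norm_sub_le _ _
          _ ≤ (‖T₁ + T₂ + Lf‖ + ‖I * Bo‖) + ‖I * Tp‖ := by gcongr; exact norm_add_le _ _
          _ ≤ ((‖T₁ + T₂‖ + ‖Lf‖) + ‖I * Bo‖) + ‖I * Tp‖ := by gcongr; exact norm_add_le _ _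
          _ ≤ (((‖T₁‖ + ‖T₂‖) + ‖Lf‖) + ‖I * Bo‖) + ‖I * Tp‖ := by gcongr; exact norm_add_le _ _
          _ = ‖T₁‖ + ‖T₂‖ + ‖Lf‖ + ‖Bo‖ + ‖Tp‖ := by
              rw [norm_mul, norm_mul, Complex.norm_I, one_mul, one_mul]
    _ ≤ 1 / (2 * π) * (2 * (Real.exp (α * Real.log x) * M_R / T') +
          Real.exp (-η * Real.log x) * M_l * (π / η) +
          2 * ((α + η) * (Real.exp (α * Real.log x) * M_h / T' ^ 2))) +
          1 / (2 * π) * (56 * Real.exp (α * Real.log x / 2) * Δ / α) := by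
        have hsum : ‖T₁‖ + ‖T₂‖ + ‖Lf‖ + ‖Bo‖ + ‖Tp‖ ≤
            2 * (Real.exp (α * Real.log x) * M_R / T') +
              Real.exp (-η * Real.log x) * M_l * (π / η) +
              2 * ((α + η) * (Real.exp (α * Real.log x) * M_h / T' ^ 2)) := by linarith
        exact add_le_add (mul_le_mul_of_nonneg_left hsum hπ0.le)
          (mul_le_mul_of_nonneg_left hnRs hπ0.le)
    _ = _ := by ring

end ContourBound

end Literature.NumberTheory.LFunctions.Zhang2022.Lemma84
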